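import Literature.RingTheory.Etale.UnramifiedModuloNilpotent
import Literature.AlgebraicGeometry.Morphisms.FlatModuloNilpotent
import Literature.AlgebraicGeometry.Morphisms.EtaleLiftDualNumber
import Mathlib.AlgebraicGeometry.Morphisms.Etale
import Mathlib.AlgebraicGeometry.Morphisms.Affine
import HarnessLib

/-!
# Unramified and étale morphisms are detected modulo a nilpotent thickening of the base

Topic `Literature/AlgebraicGeometry/Morphisms`; theorems only (no definition, no named fact, no
instance). Let `g : S₀ ⟶ S` be a morphism of AFFINE schemes whose map on global sections is
surjective with nilpotent kernel (`Spec (R/J) ⟶ Spec R` for `J` nilpotent, `Spec k ⟶ Spec k[ε]`,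
the closed point of an Artinian local ring), and let
```
P₀ --iP--> P
|f₀        |f
v          v
Q₀ --iQ--> Q
|q₀        |q
v          v
S₀ --g---> S
```
be two cartesian squares.

* `formallyUnramified_of_isPullback_of_surjective_appTop` — if `f₀` is formally unramified then so
  is `f` (no flatness, no finiteness): affine-locally `Ω_{B/A} ⊗_B B₀ = Ω_{B₀/A₀} = 0` and
  `JB` is nilpotent ([GortzWedhorn2023] Prop. 18.6, Cor. 18.8; ring form
  `Literature.RingTheory.Etale.formallyUnramified_of_isPushout_of_isNilpotent_ker`). For
  morphisms locally of finite type this is the fibrewise criterion [GortzWedhorn2023] Prop. 18.29.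
* `etale_of_isPullback_of_surjective_appTop` — if moreover the kernel of `Γ(g)` is finitely
  generated, `P` is flat over `S` and `f` is locally of finite presentation, then «`f₀` étale ⇒
  `f` étale» (étale = flat + formally unramified + locally of finite presentation, Mathlib
  `Etale.iff_flat_and_formallyUnramified`; flatness by the tree's
  `flat_of_flat_of_isPullback_of_surjective_appTop`, [Matsumura1987] Thm. 22.3 (α)).
* `Spec`-base and `k[ε]` corollaries.

## References
* [GortzWedhorn2023] U. Görtz, T. Wedhorn, *Algebraic Geometry II*, Prop. 18.6, Cor. 18.8,
  Prop. 18.29, Def. 18.34 (étale).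
* [Matsumura1987] H. Matsumura, *Commutative Ring Theory*, §22 Thm. 22.3 (α).
-/

noncomputable section

open CategoryTheory CategoryTheory.Limits AlgebraicGeometry

universe u

namespace Literature.AlgebraicGeometry.Morphisms

/-! ## §1 Affine thickenings of the base -/

section Affine

variable {S S₀ P Q P₀ Q₀ : Scheme.{u}} [IsAffine S] [IsAffine S₀] {g : S₀ ⟶ S}
  {f : P ⟶ Q} {q : Q ⟶ S} {iQ : Q₀ ⟶ Q} {q₀ : Q₀ ⟶ S₀} {f₀ : P₀ ⟶ Q₀} {iP : P₀ ⟶ P}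

/-- **Formal unramifiedness modulo a nilpotent thickening of an affine base.** Let `g : S₀ ⟶ S`
be a morphism of affine schemes with `Γ(g)` surjective with nilpotent kernel, `q : Q ⟶ S`,
`f : P ⟶ Q`, and cartesian squares `hQ : IsPullback iQ q₀ q g`, `hP : IsPullback iP f₀ f iQ`.
If `f₀` is formally unramified then so is `f`. [cite: GortzWedhorn2023, Prop. 18.6 and
Cor. 18.8 and Prop. 18.29] -/
theorem formallyUnramified_of_isPullback_of_surjective_appTop
    (hg : Function.Surjective g.appTop.hom) (hnil : IsNilpotent (RingHom.ker g.appTop.hom))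
    (hQ : IsPullback iQ q₀ q g) (hP : IsPullback iP f₀ f iQ) [FormallyUnramified f₀] :
    FormallyUnramified f := by
  haveI : IsAffineHom iQ := MorphismProperty.of_isPullback hQ.flip inferInstance
  haveI : IsAffineHom iP := MorphismProperty.of_isPullback hP.flip inferInstance
  rw [HasRingHomProperty.iff_appLE (P := @FormallyUnramified)]
  intro U V e
  have hU₀ : IsAffineOpen (iQ ⁻¹ᵁ (U : Q.Opens)) := U.2.preimage iQ
  have hV₀ : IsAffineOpen (iP ⁻¹ᵁ (V : P.Opens)) := V.2.preimage iP
  have e₀ : iP ⁻¹ᵁ (V : P.Opens) ≤ f₀ ⁻¹ᵁ (iQ ⁻¹ᵁ (U : Q.Opens)) := by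
    rw [← Scheme.Hom.comp_preimage, ← hP.w, Scheme.Hom.comp_preimage]
    exact Scheme.Hom.preimage_mono iP e
  have hUY₁ : iQ ⁻¹ᵁ (U : Q.Opens) = iQ ⁻¹ᵁ (U : Q.Opens) ⊓ q₀ ⁻¹ᵁ ⊤ := by
    simp
  have T₁ : IsPushout (q.appLE ⊤ U le_top) (g.appLE ⊤ ⊤ le_top)
      (iQ.appLE U (iQ ⁻¹ᵁ (U : Q.Opens)) le_rfl) (q₀.appLE ⊤ (iQ ⁻¹ᵁ (U : Q.Opens)) le_top) := by
    have hiso := isIso_pushoutSection_of_isAffineOpen hQ (le_top : (⊤ : S₀.Opens) ≤ g ⁻¹ᵁ ⊤)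
      (le_top : (U : Q.Opens) ≤ q ⁻¹ᵁ ⊤) hUY₁ (isAffineOpen_top S) (isAffineOpen_top S₀) U.2
    exact (isIso_pushoutSection_iff hQ _ _ hUY₁).mp hiso
  have hUY₂ : iP ⁻¹ᵁ (V : P.Opens) = iP ⁻¹ᵁ (V : P.Opens) ⊓ f₀ ⁻¹ᵁ (iQ ⁻¹ᵁ (U : Q.Opens)) :=
    (inf_eq_left.mpr e₀).symm
  have T₂ : IsPushout (f.appLE U V e) (iQ.appLE U (iQ ⁻¹ᵁ (U : Q.Opens)) le_rfl)
      (iP.appLE V (iP ⁻¹ᵁ (V : P.Opens)) le_rfl)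
      (f₀.appLE (iQ ⁻¹ᵁ (U : Q.Opens)) (iP ⁻¹ᵁ (V : P.Opens)) e₀) := by
    have hiso := isIso_pushoutSection_of_isAffineOpen hP
      (le_rfl : iQ ⁻¹ᵁ (U : Q.Opens) ≤ iQ ⁻¹ᵁ (U : Q.Opens)) e hUY₂ U.2 hU₀ V.2
    exact (isIso_pushoutSection_iff hP _ _ hUY₂).mp hiso
  have hφ₀ : (f₀.appLE (iQ ⁻¹ᵁ (U : Q.Opens)) (iP ⁻¹ᵁ (V : P.Opens)) e₀).hom.FormallyUnramified :=
    HasRingHomProperty.appLE @FormallyUnramified f₀ ‹_› ⟨_, hU₀⟩ ⟨_, hV₀⟩ e₀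
  have hg' : Function.Surjective (g.appLE ⊤ ⊤ le_top).hom := by
    rw [Scheme.Hom.appTop, Scheme.Hom.app_eq_appLE] at hg; exact hg
  have hnil' : IsNilpotent (RingHom.ker (g.appLE ⊤ ⊤ le_top).hom) := by
    rw [Scheme.Hom.appTop, Scheme.Hom.app_eq_appLE] at hnil; exact hnil
  exact Literature.RingTheory.Etale.formallyUnramified_of_isPushout_of_isNilpotent_ker hg' hnil'
    T₁ T₂ hφ₀

/-- **Étaleness modulo a nilpotent thickening of an affine base.** In the situation of
`formallyUnramified_of_isPullback_of_surjective_appTop`, assume moreover that the kernel of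
`Γ(g)` is finitely generated, that `f ≫ q` is flat (`P` flat over `S`) and that `f` is locally of
finite presentation. If `f₀` is étale then `f` is étale (étale = flat + formally unramified +
locally of finite presentation; flatness by Matsumura's Thm. 22.3 (α)).
[cite: GortzWedhorn2023, Def. 18.34 and Prop. 18.29] [cite: Matsumura1987, §22 Thm. 22.3 (α),
(3) ⇒ (1)] -/
theorem etale_of_isPullback_of_surjective_appTop
    (hg : Function.Surjective g.appTop.hom) (hnil : IsNilpotent (RingHom.ker g.appTop.hom))
    (hfg : (RingHom.ker g.appTop.hom).FG) (hQ : IsPullback iQ q₀ q g)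
    (hP : IsPullback iP f₀ f iQ) [Flat (f ≫ q)] [LocallyOfFinitePresentation f] [Etale f₀] :
    Etale f := by
  obtain ⟨_, _, _⟩ := (Etale.iff_flat_and_formallyUnramified (f := f₀)).mp ‹_›
  haveI : Flat f := flat_of_flat_of_isPullback_of_surjective_appTop hg hnil hfg hQ hP
  haveI : FormallyUnramified f :=
    formallyUnramified_of_isPullback_of_surjective_appTop hg hnil hQ hP
  exact Etale.of_formallyUnramified_of_flat f

end Affine

/-! ## §2 `Spec` bases -/

section SpecBase

variable {R R₀ : CommRingCat.{u}} {P Q P₀ Q₀ : Scheme.{u}} {f : P ⟶ Q} {q : Q ⟶ Spec R}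
  {iQ : Q₀ ⟶ Q} {q₀ : Q₀ ⟶ Spec R₀} {f₀ : P₀ ⟶ Q₀} {iP : P₀ ⟶ P}

/-- Surjectivity, kernel nilpotence and kernel finite generation pass from `ρ` to `Γ(Spec ρ)`.
[folklore] -/
private theorem appTop_specMap_transport (ρ : R ⟶ R₀) (hρ : Function.Surjective ρ.hom)
    (hnil : IsNilpotent (RingHom.ker ρ.hom)) :
    Function.Surjective (Spec.map ρ).appTop.hom ∧
      IsNilpotent (RingHom.ker (Spec.map ρ).appTop.hom) ∧
        ((RingHom.ker ρ.hom).FG → (RingHom.ker (Spec.map ρ).appTop.hom).FG) := by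
  have happ : (Spec.map ρ).appTop = (Scheme.ΓSpecIso R).hom ≫ ρ ≫ (Scheme.ΓSpecIso R₀).inv := by
    rw [← Category.assoc, ← Scheme.ΓSpecIso_naturality, Category.assoc, Iso.hom_inv_id,
      Category.comp_id]
  let e₁ : Γ(Spec R, ⊤) ≃+* R := (Scheme.ΓSpecIso R).commRingCatIsoToRingEquiv
  let e₂ : R₀ ≃+* Γ(Spec R₀, ⊤) := (Scheme.ΓSpecIso R₀).symm.commRingCatIsoToRingEquiv
  have heq : ∀ x, (Spec.map ρ).appTop.hom x = e₂ (ρ.hom (e₁ x)) := fun x =>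
    congrArg (fun φ : Γ(Spec R, ⊤) ⟶ Γ(Spec R₀, ⊤) => φ.hom x) happ
  have hker : RingHom.ker (Spec.map ρ).appTop.hom = (RingHom.ker ρ.hom).map e₁.symm := by
    rw [Ideal.map_symm]
    ext x
    simp only [RingHom.mem_ker, Ideal.mem_comap, heq, map_eq_zero_iff _ e₂.injective]
  refine ⟨?_, ?_, ?_⟩
  · intro y
    obtain ⟨r, hr⟩ := hρ (e₂.symm y)
    exact ⟨e₁.symm r, by rw [heq, RingEquiv.apply_symm_apply, hr, RingEquiv.apply_symm_apply]⟩
  · rw [hker]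
    obtain ⟨n, hn⟩ := hnil
    exact ⟨n, by rw [← Ideal.map_pow, hn, Ideal.zero_eq_bot, Ideal.map_bot, Submodule.zero_eq_bot]⟩
  · intro hfg
    rw [hker]
    exact hfg.map e₁.symm.toRingHom

/-- **Formal unramifiedness modulo a nilpotent ideal of the base ring**: `ρ : R ⟶ R₀` surjective
with nilpotent kernel, `hQ : IsPullback iQ q₀ q (Spec.map ρ)`, `hP : IsPullback iP f₀ f iQ`;
`f ⊗_R R₀` formally unramified ⇒ `f` formally unramified. [cite: GortzWedhorn2023, Prop. 18.6
and Prop. 18.29] -/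
theorem formallyUnramified_of_isPullback_specMap (ρ : R ⟶ R₀)
    (hρ : Function.Surjective ρ.hom) (hnil : IsNilpotent (RingHom.ker ρ.hom))
    (hQ : IsPullback iQ q₀ q (Spec.map ρ)) (hP : IsPullback iP f₀ f iQ)
    [FormallyUnramified f₀] : FormallyUnramified f := by
  obtain ⟨h₁, h₂, -⟩ := appTop_specMap_transport ρ hρ hnil
  exact formallyUnramified_of_isPullback_of_surjective_appTop h₁ h₂ hQ hP

/-- **Étaleness modulo a finitely generated nilpotent ideal of the base ring**: with `P` flat
over `R` and `f` locally of finite presentation, `f ⊗_R R₀` étale ⇒ `f` étale.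
[cite: GortzWedhorn2023, Def. 18.34 and Prop. 18.29] [cite: Matsumura1987, §22 Thm. 22.3 (α),
(3) ⇒ (1)] -/
theorem etale_of_isPullback_specMap (ρ : R ⟶ R₀) (hρ : Function.Surjective ρ.hom)
    (hnil : IsNilpotent (RingHom.ker ρ.hom)) (hfg : (RingHom.ker ρ.hom).FG)
    (hQ : IsPullback iQ q₀ q (Spec.map ρ)) (hP : IsPullback iP f₀ f iQ) [Flat (f ≫ q)]
    [LocallyOfFinitePresentation f] [Etale f₀] : Etale f := by
  obtain ⟨h₁, h₂, h₃⟩ := appTop_specMap_transport ρ hρ hnil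
  exact etale_of_isPullback_of_surjective_appTop h₁ h₂ (h₃ hfg) hQ hP

/-- **First-order deformations: étaleness over `k[ε]` is detected modulo `ε`** (e.g. for the
multiplication-by-`N` map of an abelian scheme over `k[ε]`): with `Spec k ⟶ Spec k[ε]` along
`TrivSqZeroExt.fst`, `P` flat over `k[ε]` and `f` locally of finite presentation,
`f ⊗_{k[ε]} k` étale ⇒ `f` étale. [cite: GortzWedhorn2023, Def. 18.34 and Prop. 18.29]
[cite: Matsumura1987, §22 Thm. 22.3 (α), (3) ⇒ (1)] -/
theorem etale_of_isPullback_specMap_dualNumber_fst {k : Type u} [CommRing k]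
    {q : Q ⟶ Spec (.of (DualNumber k))} {q₀ : Q₀ ⟶ Spec (.of k)}
    (hQ : IsPullback iQ q₀ q
      (Spec.map (CommRingCat.ofHom (TrivSqZeroExt.fstHom k k k).toRingHom)))
    (hP : IsPullback iP f₀ f iQ) [Flat (f ≫ q)] [LocallyOfFinitePresentation f] [Etale f₀] :
    Etale f := by
  obtain ⟨_, _, _⟩ := (Etale.iff_flat_and_formallyUnramified (f := f₀)).mp ‹_›
  haveI : Flat f := flat_of_flat_of_isPullback_specMap_dualNumber_fst hQ hP
  haveI : FormallyUnramified f :=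
    formallyUnramified_of_isPullback_specMap _ (dualNumber_fst_surjective k)
      ⟨2, dualNumber_ker_fst_sq_eq_bot k⟩ hQ hP
  exact Etale.of_formallyUnramified_of_flat f

end SpecBase

end Literature.AlgebraicGeometry.Morphisms
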